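import Literature.MathematicalPhysics.QuantumFieldTheory.BalabanImbrieJaffe1984to88.BIJ88RemainderW6Log
import Literature.MathematicalPhysics.QuantumFieldTheory.BalabanImbrieJaffe1984to88.BIJ88Expansion5143KP

/-!
# `BalabanImbrieJaffe1984to88.BIJ88RemainderW6Tsum` — T. Bałaban, J. Imbrie, A. Jaffe, *Effective action and cluster properties of the abelian
Higgs model*, Commun. Math. Phys. **114** (1988) 257–315 [BalabanImbrieJaffe1988]: Sect. 5.14, pp. 308–310 [PDF 52–54] — **the remainder
chain (5.14.2) → display 2 → display 4 WITH THE TRUNCATED FUNCTIONS OF DISPLAY 3** (`κ := Tsum`, the connected-graph sums of p. 310), the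
combinatorial hypotheses of this seat's gen 6 (`BIJ88RemainderW6Prime.remR_eq_sum_W6'_of_ineq5144`: normalization `z_t ≠ 0`, display 2) and of
p36's `BIJ88RemainderW6Log.log_z_one_eq_sub_pertP_sub_sum_W6'` (the same, the two summabilities, slot-locality of the truncations) DISCHARGED
from (5.14.4), the smallness of the vertex factor and the slot-locality of the activities.

p. 310 [PDF 54], verbatim: *"We put u = 1 + a and expand in the usual manner. This enables us to factor out the normalization z_t(Λ^{(k)}_{12}) …
The connected components of G define a partition of H which corresponds to the partition in the formula ⟨Π_{j∈H}[;(d/dt)_{γ_j}]⟩_t =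
Σ_{{H_γ}∈𝒫(H)} Π_γ ⟨…⟩ [display 2] … Thus we have a formula [display 3] where G_c runs over connected graphs involving all clusters X_γ, Y_δ, and
hence all of H. … ℛ_k(Λ^{(k)}_{12}) = Σ_{X⊂Λ^{(k)}_{12}} W₆^{(k)′}(X) [display 4] … It is now a standard exercise to estimate the expansion, using
(5.14.4)."*

HONEST FRAMING (cell `lit-balaban`, verbatim): statement-level skeleton of published theorems with citation tags; proofs where landed; nothing here is a claim about the Yang–Mills mass gap.

PDF held: `paper:balaban1988-cmp114-bij-abelian-higgs-effective-action` (journal page = PDF page + 256); pp. 309–310 = PDF 53–54 (`p0053.txt`,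
`p0054.txt`), read this session.

WHAT IS REPRODUCED (unit `lit-balaban-p25`, generation 12 of the Phase-2 proof seat p25; SKELETON rows `C2.Claim@310` (displays 2–4, the
*"standard exercise"*) and `C2.Eq5.14.1-5.14.2` ((5.14.2) end to end); HOME `run/shared/lean/pub/lit-balaban/lit-balaban-p25/`). Setting of gens 5/6
(`BIJ88W6PrimeBound`, `BIJ88ConnectedGraphResummation`, `BIJ88RemainderW6Prime`): cubes `V` with abutting relation `R`, the connected polymers
`polys R Λ`, derivative terms `T` located by `loc`, assignments `γ : Fin (n̄+1) → T`, activities `g₃ t γ H X`, gen 6's ordered sums `Nsum`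
(normalization / moments), `Tord`/`Tsum` (display 3), r16's `remR` ((5.14.2)), gen 5's `W6'`. Theorems only.
* §1 **`isKPVolume_of_touches`** — the standard exercise for ANY incompatibility dominated by "equal or touching" (generalizes gen 12's
  `BIJ88Expansion5143KP.isKPVolume_polysOf` from the cluster-configuration incompatibility to an arbitrary one; same animal bound
  `LatticeModels.PolymerGasGeometric.sum_kpWeight_le_of_touches`, same constant `2eε(Δ+1)² ≤ 1`).
* §2 THE NORMALIZATION: `Nsum_empty_eq_polymerPartitionFunction` (gen 6's `N(∅)` IS the hard-core partition function of the polymers of `Q` with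
  the slot-free activities, incompatibility = equal-or-overlapping), **`Nsum_empty_ne_zero_of_bound`** (`z_t = N(∅) ≠ 0` in a KP volume — the
  tree's zero-freeness `LatticeModels.polymerPartitionFunction_ne_zero_of_kp`), `kp_smallness_of_regime` (gen 5's regime `16(Δ+1)²θ^{β′/2}e² ≤ 1`
  implies the KP smallness), **`Nsum_empty_ne_zero_of_ineq5144`** (hypothesis `hz` of gens 6 / p36 DISCHARGED from (5.14.4)).
* §3 LOCALITY: `Traw_congr_local` / `Tord_congr_local` / `Tsum_congr_local` (the connected sum of the block `b` sees only the slots of `b`: their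
  locations and the activities of sub-blocks of `b`), **`Tsum_slotLocal`** (p36's hypothesis `hκloc` for `κ := Tsum`, from the slot-locality of
  `g₃ t γ H X` in `γ|_H`).
* §4 **`display2_Tsum`**: display 2 HOLDS with the display-3 truncations — `N(K)/N(∅) = Σ_{π∈𝒫(K)} Π_{b∈π} Tsum b` (gen 6's `moment_eq_Dsum` +
  `Dsum_eq_sum_setPartitions` under absolute convergence; gen 6 had stated the converse uniqueness `display3`).
* §5 THE CHAIN CLOSED: **`remR_Tsum_eq_sum_W6'`** (display 4 for the display-3 truncated function, hypotheses: (5.14.4) in gen 5's regime and the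
  `t`-integrability only), **`log_z_one_eq_of_ineq5144`** (p36's `log z₁ = log z₀ − 𝒫̃_{k+1} − (n̄+1)·Σ_X W₆′(X)` with `κ := Tsum`: of its hypotheses
  `hz`, `hT`, `hs`, `hκ`, `hκloc` NONE remains — they follow from (5.14.4) + regime + slot-locality of `g₃`; the analytic inputs `hint`, `hzC`,
  `hzpos` and the Leibniz identification `hN` of the assignment-summed moments with `z_t^{(j)}/z_t` stay displayed).
HONEST SCOPE: (a) (5.14.4) is NOT proved (typed leaf / gen 5's hypothesis shape `h5144`); (b) the bookkeeping is gens 5/6's (plain disjointness of the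
polymers; GAPS G-C2-p25-03 for the cluster-configuration reading, linked by gen 10's `BIJ88Expansion5143Connected.Nsum_polys_eq_corner_add`); (c) the
factor `n̄+1` is p36's located print slip of (5.14.2) (GAPS G-C2-p36-06); (d) nothing about `W₆″`, `𝒫^L_{k+1,loc}` (p. 311). 0 `sorry`, 0 new `Prop`
facts (D-0026); imports `BIJ88RemainderW6Log`, `BIJ88Expansion5143KP` only; modifies nothing. NOT summit progress; NOT continuum; NOT Clay.
Cell `lit-balaban` Phase 2, seat p25 gen 12 (rows owner r16, referee ref-5).
-/

noncomputable section

open Finset MeasureTheory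
open Literature.Probability.LatticeModels
open Literature.MathematicalPhysics.QuantumFieldTheory.BalabanImbrieJaffe1984to88.BIJ88Sect5StatementsPart4 (remR pertP)
open Literature.MathematicalPhysics.QuantumFieldTheory.BalabanImbrieJaffe1984to88.BIJ88Ineq5113Covering (polys mem_polys nonempty_of_mem_polys)
open Literature.MathematicalPhysics.QuantumFieldTheory.BalabanImbrieJaffe1984to88.BIJ88W6PrimeBound (assignments mem_assignments term trunc W6'
  summable_abs_term)
open Literature.MathematicalPhysics.QuantumFieldTheory.BalabanImbrieJaffe1984to88.BIJ88ConnectedGraphResummation (OWP InQ wprod Traw Tord Tsum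
  Nsum Dsum moment_eq_Dsum summable_norm_Dord Dsum_eq_sum_setPartitions)
open Literature.MathematicalPhysics.QuantumFieldTheory.BalabanImbrieJaffe1984to88.BIJ88RemainderW6Prime (remR_eq_sum_W6' summable_norm_Tord)
open Literature.MathematicalPhysics.QuantumFieldTheory.BalabanImbrieJaffe1984to88.BIJ88RemainderW6Log (log_z_one_eq_sub_pertP_sub_sum_W6')
open Literature.MathematicalPhysics.QuantumFieldTheory.BalabanImbrieJaffe1984to88.BIJ88Expansion5143 (slotsIn Covers)
open Literature.MathematicalPhysics.QuantumFieldTheory.BalabanImbrieJaffe1984to88.BIJ88Expansion5143Ordered (FamOK Nsum_eq_sum_families)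
open Literature.MathematicalPhysics.QuantumFieldTheory.BalabanImbrieJaffe1984to88.BIJ88Expansion5143KP (kpTerm_card_le_kpWeight smallness_split)

namespace Literature.MathematicalPhysics.QuantumFieldTheory.BalabanImbrieJaffe1984to88.BIJ88RemainderW6Tsum

/-! ## §1 The standard exercise for any incompatibility dominated by touching -/

section KP

variable {ι : Type*} [DecidableEq ι] {adj : ι → ι → Prop} [DecidableRel adj] {nbr : ι → Finset ι} {Δ : ℕ}

/-- **THE STANDARD EXERCISE — the Kotecký–Preiss condition from an activity bound, for any incompatibility dominated by "equal or touching"**: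
if the abutting relation is symmetric of degree `≤ Δ` (neighbours listed by `nbr`), the polymers of `Λ` incompatible with `X ∈ Λ` are equal to or
touch `X`, the activities vanish off the connected polymers and obey `‖w X‖ ≤ ε^{#X}`, `0 ≤ ε`, `2eε(Δ+1)² ≤ 1`, then `Λ` is a KP volume with the
size function `a(X) = #X`: `Σ_{Y∈Λ incompatible with X} ‖w Y‖e^{#Y} ≤ #X(Δ+1)·2eε ≤ #X`. [cite: BalabanImbrieJaffe1988, p.310 (Sect. 5.14)] -/
theorem isKPVolume_of_touches (hR : ∀ x y, adj x y → adj y x) (hΔ : ∀ x, (nbr x).card ≤ Δ) (hnbr : ∀ x y, adj x y → y ∈ nbr x)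
    {ε : ℝ} (hε : 0 ≤ ε) (hsmall : 2 * Real.exp 1 * ε * ((Δ : ℝ) + 1) ^ 2 ≤ 1)
    {inc : Finset ι → Finset ι → Prop} [DecidableRel inc] {Λ : Finset (Finset ι)}
    (htouch : ∀ X ∈ Λ, ∀ Y ∈ Λ, inc Y X → Y = X ∨ Touches adj X Y)
    {w : Finset ι → ℂ} (hz0 : ∀ X ∈ Λ, ¬ IsRConnected adj X → w X = 0) (hz : ∀ X ∈ Λ, ‖w X‖ ≤ ε ^ X.card) :
    IsKPVolume inc w (fun X => (X.card : ℝ)) Λ := by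
  intro X hX
  set lam : ℝ := Real.exp 1 * ε with hlam
  have hlam0 : 0 ≤ lam := mul_nonneg (Real.exp_pos 1).le hε
  obtain ⟨hsmall₁, hsmall₂⟩ := smallness_split (Δ := Δ) hε hsmall
  set F : Finset (Finset ι) := Λ.filter fun Y => inc Y X with hF
  have h𝒩 : ∀ Y ∈ F, Y = X ∨ Touches adj X Y := fun Y hY => htouch X hX Y (mem_filter.1 hY).1 (mem_filter.1 hY).2
  have hX0 : (0 : ℝ) ≤ X.card := Nat.cast_nonneg _
  show ∑ Y ∈ F, kpTerm w (fun X => (X.card : ℝ)) Y ≤ (X.card : ℝ)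
  calc ∑ Y ∈ F, kpTerm w (fun X => (X.card : ℝ)) Y
      ≤ ∑ Y ∈ F, kpWeight adj lam Y :=
        sum_le_sum fun Y hY => kpTerm_card_le_kpWeight (hz0 Y (mem_filter.1 hY).1) (hz Y (mem_filter.1 hY).1)
    _ ≤ X.card * ((Δ : ℝ) + 1) * (2 * lam) := sum_kpWeight_le_of_touches hR hΔ hnbr hlam0 hsmall₁ X F h𝒩
    _ = X.card * (((Δ : ℝ) + 1) * (2 * lam)) := by ring
    _ ≤ X.card * 1 := by gcongr
    _ = X.card := mul_one _

/-- **gen 5's regime implies the KP smallness**: `16(Δ+1)²θ^{β′/2}e² ≤ 1` with `0 < θ ≤ 1`, `0 ≤ β′` gives `2eθ^{β′}(Δ+1)² ≤ 1`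
(`θ^{β′} = (θ^{β′/2})² ≤ θ^{β′/2}`, `e ≤ e²`). [cite: BalabanImbrieJaffe1988, p.310 (Sect. 5.14)] -/
theorem kp_smallness_of_regime {θ β' : ℝ} (hθ0 : 0 < θ) (hθ1 : θ ≤ 1) (hβ : 0 ≤ β')
    (hsmall : 16 * ((Δ : ℝ) + 1) ^ 2 * (θ ^ (β' / 2) * Real.exp 2) ≤ 1) :
    2 * Real.exp 1 * θ ^ β' * ((Δ : ℝ) + 1) ^ 2 ≤ 1 := by
  set u : ℝ := θ ^ (β' / 2) with hu
  have hu0 : 0 ≤ u := Real.rpow_nonneg hθ0.le _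
  have hu1 : u ≤ 1 := Real.rpow_le_one hθ0.le hθ1 (by linarith)
  have hu2 : u ^ 2 ≤ u := by nlinarith
  have hθβ : θ ^ β' = u ^ 2 := by
    rw [hu, ← Real.rpow_natCast, ← Real.rpow_mul hθ0.le]
    norm_num
  have h1 : ((Δ : ℝ) + 1) ^ 2 * u * Real.exp 2 ≤ 1 / 16 := by linarith [hsmall]
  have he : Real.exp 1 ≤ Real.exp 2 := Real.exp_le_exp.2 (by norm_num)
  have hD : (0 : ℝ) ≤ ((Δ : ℝ) + 1) ^ 2 := by positivity
  calc 2 * Real.exp 1 * θ ^ β' * ((Δ : ℝ) + 1) ^ 2 = 2 * Real.exp 1 * u ^ 2 * ((Δ : ℝ) + 1) ^ 2 := by rw [hθβ]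
    _ ≤ 2 * Real.exp 2 * u * ((Δ : ℝ) + 1) ^ 2 := by gcongr
    _ = 2 * (((Δ : ℝ) + 1) ^ 2 * u * Real.exp 2) := by ring
    _ ≤ 2 * (1 / 16) := by gcongr
    _ ≤ 1 := by norm_num

end KP

/-! ## §2 The normalization `z_t = N(∅)` is a hard-core partition function; §3 locality; §4 display 2 for `Tsum` (generic carriers) -/

section Generic

variable {V : Type*} {S : Type*} [DecidableEq V] [Fintype V] [DecidableEq S] [Fintype S] {Q : Finset (Finset V)} {loc : S → V}
  {w : Finset S → Finset V → ℝ}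

/-- **gen 6's normalization `N(∅)` IS the hard-core partition function** of the polymers of `Q` with the slot-free activities `w(∅, ·)`, for any
incompatibility that reads "overlapping" on distinct polymers of `Q` (p. 310: *"the normalization z_t(Λ^{(k)}_{12})"* — the expansion with no
`t`-derivatives, `{Y_δ}` nonoverlapping). [cite: BalabanImbrieJaffe1988, p.310 (Sect. 5.14)] -/
theorem Nsum_empty_eq_polymerPartitionFunction (inc : Finset V → Finset V → Prop) [DecidableRel inc]
    (hinc : ∀ X ∈ Q, ∀ Y ∈ Q, X ≠ Y → (¬ inc X Y ↔ Disjoint X Y)) (hQ : ∅ ∉ Q) :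
    ((Nsum Q loc w ∅ : ℝ) : ℂ) = polymerPartitionFunction inc (fun X => ((w ∅ X : ℝ) : ℂ)) Q := by
  rw [Nsum_eq_sum_families (Q := Q) (loc := loc) (w := w) hQ ∅, polymerPartitionFunction, sum_filter]
  push_cast
  refine sum_congr rfl fun F hF => ?_
  have hFQ : F ⊆ Q := mem_powerset.1 hF
  have hiff : FamOK loc ∅ F ↔ IsCompatible inc F := by
    constructor
    · rintro ⟨hd, -⟩ X hX Y hY hne
      exact (hinc X (hFQ hX) Y (hFQ hY) hne).2 (hd X hX Y hY hne)
    · intro hc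
      refine ⟨fun X hX Y hY hne => (hinc X (hFQ hX) Y (hFQ hY) hne).1 (hc hX hY hne), fun j hj => absurd hj (notMem_empty j)⟩
  by_cases h : FamOK loc ∅ F
  · rw [if_pos h, if_pos (hiff.1 h)]
    push_cast
    refine prod_congr rfl fun X _ => ?_
    have : slotsIn loc (∅ : Finset S) X = ∅ := by simp [slotsIn]
    rw [this]
  · rw [if_neg h, if_neg (mt hiff.2 h)]
    push_cast
    rfl

/-- **the connected sum of the block `b` sees only the slots of `b`**: gen 6's raw connected sum `Traw Q loc w ι b` is unchanged when the slot
locations agree on `b` and the activities agree on the sub-blocks of `b` (an ordered weak partition `(H_i)` of `b` has every `H_i ⊆ b`).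
[cite: BalabanImbrieJaffe1988, p.310 (Sect. 5.14)] -/
theorem Traw_congr_local {ι : Type*} [Fintype ι] [DecidableEq ι] {loc₁ loc₂ : S → V} {w₁ w₂ : Finset S → Finset V → ℝ} {b : Finset S}
    (hloc : ∀ j ∈ b, loc₁ j = loc₂ j) (hw : ∀ H ⊆ b, ∀ X, w₁ H X = w₂ H X) : Traw Q loc₁ w₁ ι b = Traw Q loc₂ w₂ ι b := by
  unfold Traw
  refine sum_congr rfl fun Hs _ => sum_congr rfl fun Z _ => ?_
  by_cases ho : OWP b Hs
  · have hsub : ∀ i, Hs i ⊆ b := fun i => by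
      rw [← ho.2]
      exact subset_biUnion_of_mem Hs (mem_univ i)
    have hcov : BIJ88ConnectedGraphResummation.Cov loc₁ Hs Z ↔ BIJ88ConnectedGraphResummation.Cov loc₂ Hs Z := by
      unfold BIJ88ConnectedGraphResummation.Cov
      exact forall_congr' fun i => forall₂_congr fun j hj => by rw [hloc j (hsub i hj)]
    have hwp : wprod w₁ Hs Z = wprod w₂ Hs Z := prod_congr rfl fun i _ => hw (Hs i) (hsub i) (Z i)
    simp only [hcov, hwp]
  · rw [if_neg fun h => ho h.1, if_neg fun h => ho h.1]

/-- the same for the weighted `m`-cluster term `Tord`. [cite: BalabanImbrieJaffe1988, p.310 (Sect. 5.14)] -/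
theorem Tord_congr_local {loc₁ loc₂ : S → V} {w₁ w₂ : Finset S → Finset V → ℝ} {b : Finset S}
    (hloc : ∀ j ∈ b, loc₁ j = loc₂ j) (hw : ∀ H ⊆ b, ∀ X, w₁ H X = w₂ H X) (m : ℕ) : Tord Q loc₁ w₁ m b = Tord Q loc₂ w₂ m b := by
  unfold Tord
  rw [Traw_congr_local hloc hw]

/-- … and for the connected series `Tsum` of display 3. [cite: BalabanImbrieJaffe1988, p.310 (Sect. 5.14)] -/
theorem Tsum_congr_local {loc₁ loc₂ : S → V} {w₁ w₂ : Finset S → Finset V → ℝ} {b : Finset S}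
    (hloc : ∀ j ∈ b, loc₁ j = loc₂ j) (hw : ∀ H ⊆ b, ∀ X, w₁ H X = w₂ H X) : Tsum Q loc₁ w₁ b = Tsum Q loc₂ w₂ b := by
  unfold Tsum
  exact tsum_congr fun m => Tord_congr_local hloc hw m

/-- **DISPLAY 2 OF p. 310 WITH `κ := Tsum`**: if `∅ ∉ Q`, the normalization `N(∅) ≠ 0` and the connected series of every nonempty sub-block of
`K` converges absolutely, then `N(K)/N(∅) = Σ_{π ∈ 𝒫(K)} Π_{b∈π} Tsum(b)` — the truncated functions of display 2 ARE the connected-graph sums of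
display 3 (gen 6: `moment_eq_Dsum`, `Dsum_eq_sum_setPartitions`; the uniqueness direction is gen 6's `display3`).
[cite: BalabanImbrieJaffe1988, p.310 (Sect. 5.14)] -/
theorem display2_Tsum (hQ : ∅ ∉ Q) (hz : Nsum Q loc w ∅ ≠ 0) {K : Finset S}
    (hT : ∀ b ⊆ K, b.Nonempty → Summable fun m => ‖Tord Q loc w m b‖) :
    Nsum Q loc w K / Nsum Q loc w ∅ = ∑ π ∈ setPartitions K, ∏ b ∈ π, Tsum Q loc w b := by
  rw [moment_eq_Dsum Q loc w hQ hz K (summable_norm_Dord Q loc w K hT), Dsum_eq_sum_setPartitions Q loc w K hT]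

end Generic

/-! ## §2 (continued) `z_t ≠ 0`; §3 `hκloc` for `Tsum`; §5 the chain closed — in gens 5/6's model (`V`, `T` in `Type`, as `polys`) -/

section Model

variable {V : Type} [DecidableEq V] [Fintype V] {T : Type}
variable {R : V → V → Prop} {nbar : ℕ} {Γ : Finset T} {loc : T → V}
  {g₃ : ℝ → (Fin (nbar + 1) → T) → Finset (Fin (nbar + 1)) → Finset V → ℝ}
variable {nbr : V → Finset V} {Δ : ℕ} {θ β' : ℝ}

/-- **`z_t = N(∅) ≠ 0` in the KP regime** (p. 310: *"This enables us to factor out the normalization z_t(Λ^{(k)}_{12})"*): if `R` is symmetric of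
degree `≤ Δ` and the slot-free activities of the connected polymers of `Λ` satisfy `|w(∅, X)| ≤ ε^{#X}` with `0 ≤ ε`, `2eε(Δ+1)² ≤ 1`, then gen 6's
normalization over `polys R Λ` does not vanish (zero-freeness of the hard-core gas, `LatticeModels.polymerPartitionFunction_ne_zero_of_kp`, for
the incompatibility "equal or overlapping"). [cite: BalabanImbrieJaffe1988, p.310 (Sect. 5.14)] -/
theorem Nsum_empty_ne_zero_of_bound [DecidableRel R] {S : Type*} [DecidableEq S] [Fintype S] {loc' : S → V} {w : Finset S → Finset V → ℝ}
    (hR : ∀ x y, R x y → R y x) (hΔ : ∀ x, (nbr x).card ≤ Δ) (hnbr : ∀ x y, R x y → y ∈ nbr x)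
    {ε : ℝ} (hε : 0 ≤ ε) (hsmall : 2 * Real.exp 1 * ε * ((Δ : ℝ) + 1) ^ 2 ≤ 1) (Λ : Finset V)
    (hz : ∀ X ∈ polys R Λ, |w ∅ X| ≤ ε ^ X.card) : Nsum (polys R Λ) loc' w ∅ ≠ 0 := by
  classical
  -- incompatibility: equal or overlapping
  let inc : Finset V → Finset V → Prop := fun X Y => X = Y ∨ ¬ Disjoint X Y
  haveI : Std.Refl inc := ⟨fun X => Or.inl rfl⟩
  haveI : Std.Symm inc := ⟨fun X Y h => h.elim (fun h => Or.inl h.symm) fun h => Or.inr fun d => h d.symm⟩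
  have hQ : (∅ : Finset V) ∉ polys R Λ := fun h => (nonempty_of_mem_polys h).ne_empty rfl
  have hinc : ∀ X ∈ polys R Λ, ∀ Y ∈ polys R Λ, X ≠ Y → (¬ inc X Y ↔ Disjoint X Y) := fun X _ Y _ hne =>
    ⟨fun h => not_not.1 fun hd => h (Or.inr hd), fun hd h => h.elim hne fun h => h hd⟩
  have hKP : IsKPVolume inc (fun X => ((w ∅ X : ℝ) : ℂ)) (fun X => (X.card : ℝ)) (polys R Λ) := by
    refine isKPVolume_of_touches hR hΔ hnbr hε hsmall (fun X _ Y _ h => ?_) (fun X hX hc => absurd (mem_polys.1 hX).2 hc) fun X hX => ?_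
    · rcases h with h | h
      · exact Or.inl h
      · obtain ⟨c, hcY, hcX⟩ := not_disjoint_iff.1 h
        exact Or.inr ⟨c, hcX, c, hcY, Or.inl rfl⟩
    · rw [Complex.norm_real, Real.norm_eq_abs]
      exact hz X hX
  intro h0
  have h := polymerPartitionFunction_ne_zero_of_kp hKP subset_rfl
  rw [← Nsum_empty_eq_polymerPartitionFunction inc hinc hQ, h0, Complex.ofReal_zero] at h
  exact h rfl

/-- **p36's `hκloc` FOR `κ := Tsum`**: if the activity `g₃ t γ H X` depends on the assignment `γ` only through `γ|_H` (the `t`-derivatives located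
in the polymer — p. 308: *"(d/dt)_γ acts only on the t before a particular term"*), then the display-3 truncated function of the block `B` depends on
`γ` only through `γ|_B`. [cite: BalabanImbrieJaffe1988, p.310 (Sect. 5.14)] -/
theorem Tsum_slotLocal (hg : ∀ t (H : Finset (Fin (nbar + 1))) (X : Finset V) (γ γ' : Fin (nbar + 1) → T),
      (∀ j ∈ H, γ j = γ' j) → g₃ t γ H X = g₃ t γ' H X)
    (Λ : Finset V) (t : ℝ) (B : Finset (Fin (nbar + 1))) {γ γ' : Fin (nbar + 1) → T} (h : ∀ j ∈ B, γ j = γ' j) :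
    Tsum (polys R Λ) (loc ∘ γ) (g₃ t γ) B = Tsum (polys R Λ) (loc ∘ γ') (g₃ t γ') B :=
  Tsum_congr_local (fun j hj => by rw [Function.comp_apply, Function.comp_apply, h j hj])
    fun H hH X => hg t H X γ γ' fun j hj => h j (hH hj)

/-- **`z_t = N(∅) ≠ 0` FROM (5.14.4)** — hypothesis `hz` of gen 6's `remR_eq_sum_W6'_of_ineq5144` and of p36's `log_z_one_eq_sub_pertP_sub_sum_W6'`
DISCHARGED: in gen 5's regime (`R` symmetric of degree `≤ Δ`, `0 < θ ≤ 1`, `0 ≤ β′`, `16(Δ+1)²θ^{β′/2}e² ≤ 1`), (5.14.4) on `[0,1]` gives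
`|g₃ᵗ(γ, ∅, X)| ≤ θ^{β′#X}` hence the KP condition hence `N_γ(∅) ≠ 0`, for every `t ∈ [0,1]` and every assignment `γ`.
[cite: BalabanImbrieJaffe1988, (5.14.4) p.309, p.310 (Sect. 5.14)] -/
theorem Nsum_empty_ne_zero_of_ineq5144 [DecidableRel R] (hR : ∀ x y, R x y → R y x) (hΔ : ∀ x, (nbr x).card ≤ Δ)
    (hnbr : ∀ x y, R x y → y ∈ nbr x) (hθ0 : 0 < θ) (hθ1 : θ ≤ 1) (hβ : 0 ≤ β')
    (hsmall : 16 * ((Δ : ℝ) + 1) ^ 2 * (θ ^ (β' / 2) * Real.exp 2) ≤ 1)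
    (h5144 : ∀ t ∈ Set.Icc (0 : ℝ) 1, ∀ (γ : Fin (nbar + 1) → T) (K : Finset (Fin (nbar + 1))) (Y : Finset V),
      (∀ j ∈ K, loc (γ j) ∈ Y) → |g₃ t γ K Y| ≤ θ ^ ((K.card : ℝ) + β' * ((Y \ K.image fun j => loc (γ j)).card : ℝ)))
    (Λ : Finset V) {t : ℝ} (ht : t ∈ Set.Icc (0 : ℝ) 1) (γ : Fin (nbar + 1) → T) :
    Nsum (polys R Λ) (loc ∘ γ) (g₃ t γ) ∅ ≠ 0 := by
  refine Nsum_empty_ne_zero_of_bound (w := g₃ t γ) hR hΔ hnbr (Real.rpow_nonneg hθ0.le β') (kp_smallness_of_regime hθ0 hθ1 hβ hsmall) Λ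
    fun X _ => ?_
  have h := h5144 t ht γ ∅ X fun j hj => absurd hj (notMem_empty j)
  simp only [card_empty, Nat.cast_zero, zero_add, image_empty, sdiff_empty] at h
  rwa [← Real.rpow_natCast, ← Real.rpow_mul hθ0.le]

variable (R nbar Γ loc g₃) in
/-- **DISPLAY 4 FOR THE DISPLAY-3 TRUNCATED FUNCTION, CLOSED** (p. 310: *"ℛ_k(Λ^{(k)}_{12}) = Σ_{X⊂Λ^{(k)}_{12}} W₆^{(k)′}(X)"*): in gen 5's regime with
(5.14.4) on `[0,1]` and the `t`-integrals of (5.14.2) existing region by region, the remainder `remR` of (5.14.2) of the assignment-summed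
display-3 truncated function `t ↦ Σ_γ Tsum_γ(H)` equals `Σ_{X⊆Λ} W₆′(X)` — no normalization, display-2 or summability hypothesis left (gen 6's
`remR_eq_sum_W6'` + `Tsum_univ_eq_sum_trunc`, the term series converging by gen 5's `summable_abs_term`).
[cite: BalabanImbrieJaffe1988, p.310 (Sect. 5.14)] -/
theorem remR_Tsum_eq_sum_W6' (hR : ∀ x y, R x y → R y x) (hΔ : ∀ x, (nbr x).card ≤ Δ) (hnbr : ∀ x y, R x y → y ∈ nbr x)
    (hθ0 : 0 < θ) (hθ1 : θ ≤ 1) (hβ : 0 ≤ β') (hsmall : 16 * ((Δ : ℝ) + 1) ^ 2 * (θ ^ (β' / 2) * Real.exp 2) ≤ 1)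
    (h5144 : ∀ t ∈ Set.Icc (0 : ℝ) 1, ∀ (γ : Fin (nbar + 1) → T) (K : Finset (Fin (nbar + 1))) (Y : Finset V),
      (∀ j ∈ K, loc (γ j) ∈ Y) → |g₃ t γ K Y| ≤ θ ^ ((K.card : ℝ) + β' * ((Y \ K.image fun j => loc (γ j)).card : ℝ)))
    (Λ : Finset V)
    (hint : ∀ X ⊆ Λ, IntervalIntegrable (fun t => ∑ γ ∈ assignments nbar Γ loc X, trunc R nbar loc g₃ t γ X) volume 0 1) :
    remR (fun t => ∑ γ ∈ assignments nbar Γ loc Λ, Tsum (polys R Λ) (loc ∘ γ) (g₃ t γ) univ) nbar =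
      ∑ X ∈ Λ.powerset, W6' R nbar Γ loc g₃ X := by
  have hI : Set.uIcc (0 : ℝ) 1 = Set.Icc 0 1 := Set.uIcc_of_le zero_le_one
  refine remR_eq_sum_W6' R nbar Γ loc g₃ Λ (fun t γ => Tsum (polys R Λ) (loc ∘ γ) (g₃ t γ) univ) (fun t ht γ _ => ?_) hint
  exact BIJ88RemainderW6Prime.Tsum_univ_eq_sum_trunc R nbar loc g₃ t γ Λ fun X _ =>
    (summable_abs_term hR hΔ hnbr hθ0 hθ1 hβ hsmall h5144 (hI ▸ ht) γ X).of_abs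

variable (R nbar Γ loc g₃) in
/-- **p36's `log z₁ = log z₀ − 𝒫̃_{k+1} − (n̄+1)·Σ_{X⊂Λ₁₂} W₆^{(k)′}(X)` WITH `κ := Tsum`, ITS COMBINATORIAL HYPOTHESES DISCHARGED**: of the hypotheses
of `BIJ88RemainderW6Log.log_z_one_eq_sub_pertP_sub_sum_W6'` — normalization `≠ 0` (`hz`), absolute convergence of the connected series (`hT`) and of
the term series (`hs`), display 2 (`hκ`), slot-locality of the truncations (`hκloc`) — NONE remains: they follow from (5.14.4) in gen 5's regime
(`Nsum_empty_ne_zero_of_ineq5144`, gen 6's `summable_norm_Tord`, gen 5's `summable_abs_term`, `display2_Tsum`) and from the slot-locality of the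
activities `g₃ t γ H X` in `γ|_H` (`Tsum_slotLocal`). What stays displayed is analytic: the `t`-integrability `hint`, a positive `C^{n̄+1}`
function `z` on `[0,1]` (`hzC`, `hzpos`) and the Leibniz identification `hN` of the assignment-summed normalized moments with `z_t^{(j)}/z_t`
(p. 308: *"We express each d/dt as a sum Σ_γ (d/dt)_γ"*). The factor `n̄+1` is p36's located print slip of (5.14.2) (GAPS G-C2-p36-06).
[cite: BalabanImbrieJaffe1988, (5.14.2) p.308, (5.14.4) p.309, p.310 (Sect. 5.14)] -/
theorem log_z_one_eq_of_ineq5144 [DecidableRel R] (hR : ∀ x y, R x y → R y x) (hΔ : ∀ x, (nbr x).card ≤ Δ)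
    (hnbr : ∀ x y, R x y → y ∈ nbr x) (hθ0 : 0 < θ) (hθ1 : θ ≤ 1) (hβ : 0 ≤ β')
    (hsmall : 16 * ((Δ : ℝ) + 1) ^ 2 * (θ ^ (β' / 2) * Real.exp 2) ≤ 1)
    (h5144 : ∀ t ∈ Set.Icc (0 : ℝ) 1, ∀ (γ : Fin (nbar + 1) → T) (K : Finset (Fin (nbar + 1))) (Y : Finset V),
      (∀ j ∈ K, loc (γ j) ∈ Y) → |g₃ t γ K Y| ≤ θ ^ ((K.card : ℝ) + β' * ((Y \ K.image fun j => loc (γ j)).card : ℝ)))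
    (hg : ∀ t (H : Finset (Fin (nbar + 1))) (X : Finset V) (γ γ' : Fin (nbar + 1) → T),
      (∀ j ∈ H, γ j = γ' j) → g₃ t γ H X = g₃ t γ' H X)
    (Λ : Finset V) {s₀ : T} (hs₀ : s₀ ∈ Γ.filter fun τ => loc τ ∈ Λ)
    (hint : ∀ X ⊆ Λ, IntervalIntegrable (fun t => ∑ γ ∈ assignments nbar Γ loc X, trunc R nbar loc g₃ t γ X) volume 0 1)
    {z : ℝ → ℝ} (hzC : ContDiffOn ℝ (nbar + 1 : ℕ) z (Set.uIcc 0 1)) (hzpos : ∀ t ∈ Set.uIcc (0 : ℝ) 1, 0 < z t)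
    (hN : ∀ t ∈ Set.uIcc (0 : ℝ) 1, ∀ K : Finset (Fin (nbar + 1)), K.Nonempty →
      ∑ γ ∈ Fintype.piFinset (fun j => if j ∈ K then Γ.filter (fun τ => loc τ ∈ Λ) else {s₀}),
        Nsum (polys R Λ) (loc ∘ γ) (g₃ t γ) K / Nsum (polys R Λ) (loc ∘ γ) (g₃ t γ) ∅ =
          iteratedDerivWithin K.card z (Set.uIcc 0 1) t / z t) :
    Real.log (z 1) = Real.log (z 0) - pertP (fun x => Real.log (z x)) nbar -
      (nbar + 1 : ℝ) * ∑ X ∈ Λ.powerset, W6' R nbar Γ loc g₃ X := by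
  have hI : Set.uIcc (0 : ℝ) 1 = Set.Icc 0 1 := Set.uIcc_of_le zero_le_one
  have hQ : (∅ : Finset V) ∉ polys R Λ := fun h => (nonempty_of_mem_polys h).ne_empty rfl
  have hz' : ∀ t ∈ Set.uIcc (0 : ℝ) 1, ∀ γ : Fin (nbar + 1) → T, Nsum (polys R Λ) (loc ∘ γ) (g₃ t γ) ∅ ≠ 0 :=
    fun t ht γ => Nsum_empty_ne_zero_of_ineq5144 hR hΔ hnbr hθ0 hθ1 hβ hsmall h5144 Λ (hI ▸ ht) γ
  have hT' : ∀ t ∈ Set.uIcc (0 : ℝ) 1, ∀ γ : Fin (nbar + 1) → T, ∀ b : Finset (Fin (nbar + 1)), b.Nonempty →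
      Summable fun m => ‖Tord (polys R Λ) (loc ∘ γ) (g₃ t γ) m b‖ :=
    fun t ht γ b hb => summable_norm_Tord hR hΔ hnbr hθ0 hθ1 hβ hsmall (h5144 t (hI ▸ ht) γ) Λ hb
  exact log_z_one_eq_sub_pertP_sub_sum_W6' (R := R) (g₃ := g₃) Λ hs₀ (fun t γ b => Tsum (polys R Λ) (loc ∘ γ) (g₃ t γ) b)
    (fun t ht γ _ => hz' t ht γ) (fun t ht γ _ b hb => hT' t ht γ b hb)
    (fun t ht γ _ X _ => (summable_abs_term hR hΔ hnbr hθ0 hθ1 hβ hsmall h5144 (hI ▸ ht) γ X).of_abs)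
    (fun t ht γ _ K hK => display2_Tsum hQ (hz' t ht γ) fun b _ hb => hT' t ht γ b hb) hint
    (fun t B γ _ γ' _ hB => Tsum_slotLocal hg Λ t B hB) hzC hzpos hN

end Model

end Literature.MathematicalPhysics.QuantumFieldTheory.BalabanImbrieJaffe1984to88.BIJ88RemainderW6Tsum
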